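import Summits.BirchSwinnertonDyer.BirchSwinnertonDyer.Theorems.UniversalToricDescentTwinSplitVanishingControl
import Summits.BirchSwinnertonDyer.BirchSwinnertonDyer.Theorems.UniversalToricDescentTwinSplitSelmerCountPrimaryRed
import Literature.NumberTheory.EllipticCurves.PadicFormalLogOrder
import HarnessLib

/-!
# Route `UniversalToricDescent`, children `TwinSplitIMCAtThreeGoodSS` (20695, bucket C) and `TwinSplitIMCAtThreeMult`
# (20694, bucket B), tier U: the SELMER HALF `Ch_Λ(X_ac(E′/K_∞) strict at 𝔭′) = Λ` at a rank-one UNIT pair,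
# CONTROL-FREE — from the X11b exact count + vanishing control, modulo two cited cohomological named facts

Mathematics and Lean text: planner `bsd-wall-utd-idea` g4 (`Sketch-utd-idea-g4.lean` sha16 d3f248362826f0d9, §3 atoms
T1a and §3c VERBATIM; card `Ideas/idea-unit-pair-vanishing-control.md`, LENS-MEMO-UTD-IDEA-v6). Landed by prover seat
`bsd-wall-utd-p2` g3 (TURNKEY-3 (c2)). The typed-stub `def`s of the sketch's §3 (`IsUnitHeegnerPair`, `UnitPair…`,
`SelmerSideTrivialU/C`, `OtherPrimeDegreeOne`, `UnitPairHIdx`) are NOT landed (proof files carry no definitions);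
only the theorems the two instances use are.

* `noThreeTorsionAtPrime_of_goodSS` / `noThreeTorsionAtPrime_of_mult` — atom T1a: `E′(K_{𝔭′})[3] = 0` at a good-ss
  `3` (`#Ẽ′(𝔽₃) ∈ {1,4,7}`) resp. a multiplicative `3` under the printed side condition (non-split or `3 ∤ v₃ Δ_min`).
* `tamagawaProductAbove_dvd_tamagawaProduct` — `∏_{w∣p} c_w ∣ ∏_w c_w`.
* **`selmerHalf_instance_of_mult_unit`** (bucket B) / **`selmerHalf_instance_of_goodSS_unit`** (bucket C): at a
  rank-one UNIT datum (`P ∈ E′(K)` non-torsion, `ord₃ log_ω P = 1` at `embAt K 3 𝔭′`, `3 ∤ ∏_w c_w(E′/K)`,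
  `3 ∤ [E′(K):ℤP]`, `rank E′(K) = 1`, `Ш(E′/K)[3^∞] = 0`), `XAc.HasCharValuationAt (E′/K) 3 κ 𝔭′ ∅ γ 0` — the X11b
  exact count (`baseSelmerCountAt_of_rankOne_primary` / `…_primary_red`) gives `#Sel_{𝔭′}(K, E′[3^∞]) = 3^0`, then
  `VanishingControl.hasCharValuationAt_zero_of_atoms`. CONDITIONAL ONLY on `poitouTate_selmerStructure_duality K`
  (Milne ADT I 4.10(b)) and `localEulerPoincareCharacteristic` (I 2.8). No JSW17 3.3.1 / Castella 2.3 control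
  theorem, no CÇSS18 claim, no Λ-adic or analytic input, no numeric `hIdx`.

Companion (same seat, control WITH count): `…GoodSSUnitTier` (p555429) / `…MultValueRoute` §5 (p553371) — there
JSW 2017 Thm. 3.3.1 gives `Ch = (F)` with `ord₃ F(0) = 0`; here the two Milne facts do. Either feeds the analytic
unit tier (`Ch·R₀⟦T⟧ = ⊤ = (L′)` for every frame: `…MultUnitTierFlat` p554486, `…GoodSSUnitTier`).
PARTITION: C_unit ≥ 266 / 603, B_unit ≥ 231 / 675 (census QU1 / QU1B-FULL). Beyond-print BSD theorem: NO.
`--supports stmt-BirchSwinnertonDyer-20695`.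

References: [JetchevSkinnerWan2017] Prop. 3.2.1, (7.1.5); [GreenbergLNM1716] §3 Lemma 3.3, §4; [GrossLMS1991] §2
Props. 2.1, 2.3; [Kim2022StructureSelmer] §3.1.1; [SilvermanAEC2009] IV.6.1, VII.2.1, VII.3.1, VII.6.1/6.2;
[MilneADT2006] I Thm. 4.10(b), Thm. 2.8.
-/

set_option linter.dupNamespace false
set_option autoImplicit false

noncomputable section

open scoped Classical

open NumberField IsDedekindDomain Field
open Literature.NumberTheory.EllipticCurves Literature.NumberTheory.EllipticCurves.GreenbergSelmer
open Literature.NumberTheory.GaloisRepresentations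

namespace Summit.BirchSwinnertonDyer.BirchSwinnertonDyer.Theorems.UniversalToricDescentTwinSplit.VanishingControl

open Summit.BirchSwinnertonDyer.Rank1Residual.X11b
open Summit.BirchSwinnertonDyer.Rank1Residual.X11b.AcSelmer
open Literature.NumberTheory.EllipticCurves.Rank1Residual

/-! ## Atom T1a: no `3`-torsion over `K_{𝔭′} ≅ ℚ₃` -/

/-- **T1a HOLDS on bucket C** (good supersingular at `3`): `3 ∣ a_3` excludes `a_3 ≡ 1 (mod 3)`,
so `E'(ℚ_3)[3] = 0` by the tree's `localTorsion_eq_zero_of_good_of_not_dvd_frobeniusTrace_sub_one`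
(AEC VII.2.1 + VII.3.1/IV.6.1), transported to `K_{𝔭'} ≅ ℚ_3`.
[cite: SilvermanAEC2009, VII.2 Prop. 2.1, VII.3 Prop. 3.1 (with IV.6 Thm. 6.1)] -/
theorem noThreeTorsionAtPrime_of_goodSS (W' : WeierstrassCurve ℚ) [W'.IsElliptic]
    [W'.IsGloballyMinimal] (hss : GoodSS W' 3) (K : Type) [Field K] [NumberField K]
    (𝔭' : HeightOneSpectrum (𝓞 K)) (h𝔭' : ((3 : ℕ) : 𝓞 K) ∈ 𝔭'.asIdeal)
    (he' : 𝔭'.asIdeal.ramificationIdx (𝓞 ℚ) = 1) (hf' : 𝔭'.asIdeal.inertiaDeg (𝓞 ℚ) = 1) :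
    ∀ R : ((W'.baseChange K).baseChange (𝔭'.adicCompletion K)).toAffine.Point, 3 • R = 0 → R = 0 := by
  obtain ⟨e⟩ := exists_ringHom_adicCompletion_padic_of_degreeOne (p := 3) 𝔭' h𝔭' he' hf'
  refine noPTorsion_baseChange_adicCompletion_of_padic W' 3 𝔭' e
    (localTorsion_eq_zero_of_good_of_not_dvd_frobeniusTrace_sub_one W' 3 le_rfl hss.1 fun h1 ↦ ?_)
  have hone : ((3 : ℕ) : ℤ) ∣ 1 := by simpa using dvd_sub hss.2 h1
  have h3 : ((3 : ℕ) : ℤ) ≤ 1 := Int.le_of_dvd one_pos hone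
  omega


/-- **T1a HOLDS on bucket B under the printed side condition** (multiplicative at `3`, non-split or
`3 ∤ v_3(Δ_min)` — for a unit pair with split reduction `c_3 = v_3(Δ_min)` is prime to `3`): the
tree's `LocalTorsionMult.localTorsion_eq_zero_of_mult` (AEC VII.2.1, VII.3.1, VII.6.1), transported
to `K_{𝔭'} ≅ ℚ_3`. [cite: SilvermanAEC2009, VII.3 Prop. 3.1, Thm VII.6.1, Exercise 3.5] -/
theorem noThreeTorsionAtPrime_of_mult (W' : WeierstrassCurve ℚ) [W'.IsElliptic]
    [W'.IsGloballyMinimal] (hm : W'.HasMultiplicativeReductionAtPrime 3)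
    (hside : ¬ W'.HasSplitMultiplicativeReductionAtPrime 3 ∨
      ¬ 3 ∣ padicValInt 3 W'.minimalDiscriminantInt)
    (K : Type) [Field K] [NumberField K]
    (𝔭' : HeightOneSpectrum (𝓞 K)) (h𝔭' : ((3 : ℕ) : 𝓞 K) ∈ 𝔭'.asIdeal)
    (he' : 𝔭'.asIdeal.ramificationIdx (𝓞 ℚ) = 1) (hf' : 𝔭'.asIdeal.inertiaDeg (𝓞 ℚ) = 1) :
    ∀ R : ((W'.baseChange K).baseChange (𝔭'.adicCompletion K)).toAffine.Point, 3 • R = 0 → R = 0 := by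
  obtain ⟨e⟩ := exists_ringHom_adicCompletion_padic_of_degreeOne (p := 3) 𝔭' h𝔭' he' hf'
  exact noPTorsion_baseChange_adicCompletion_of_padic W' 3 𝔭' e
    (LocalTorsionMult.localTorsion_eq_zero_of_mult W' 3 le_rfl hm hside)


/-! ## The Selmer half at a rank-one unit datum (buckets B and C) -/

/-- `∏_{w ∣ p} c_w(E/K)` divides `∏_w c_w(E/K)` (both `finprod`s over the finite bad support). [folklore] -/
theorem tamagawaProductAbove_dvd_tamagawaProduct (W' : WeierstrassCurve ℚ) [W'.IsElliptic]
    (K : Type) [Field K] [NumberField K] (p : ℕ) :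
    tamagawaProductAbove W' K p ∣ (W'.baseChange K).tamagawaProduct := by
  haveI : (W'.baseChange K).IsElliptic := by rw [WeierstrassCurve.baseChange]; infer_instance
  have hfin : (Function.mulSupport fun w : HeightOneSpectrum (𝓞 K) =>
      ((W'.baseChange K).baseChange (w.adicCompletion K)).localTamagawaNumber
        (w.adicCompletionIntegers K)).Finite :=
    (W'.baseChange K).mulSupport_localTamagawaNumber_finite_holds
  have hfs : (Function.mulSupport fun w : HeightOneSpectrum (𝓞 K) =>
      ((W'.baseChange K).baseChange (w.adicCompletion K)).localTamagawaNumber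
        (w.adicCompletionIntegers K)) ⊆ ↑hfin.toFinset := by
    rw [Set.Finite.coe_toFinset]
  have hgs : (Function.mulSupport fun w : HeightOneSpectrum (𝓞 K) =>
      if ((p : ℕ) : 𝓞 K) ∈ w.asIdeal then
        ((W'.baseChange K).baseChange (w.adicCompletion K)).localTamagawaNumber
          (w.adicCompletionIntegers K)
      else 1) ⊆ ↑hfin.toFinset := by
    rw [Set.Finite.coe_toFinset]
    intro w hw
    rw [Function.mem_mulSupport] at hw ⊢
    by_cases h : ((p : ℕ) : 𝓞 K) ∈ w.asIdeal
    · simpa [h] using hw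
    · simp [h] at hw
  rw [tamagawaProductAbove, WeierstrassCurve.tamagawaProduct,
    finprod_eq_prod_of_mulSupport_subset _ hgs, finprod_eq_prod_of_mulSupport_subset _ hfs]
  refine Finset.prod_dvd_prod_of_dvd _ _ fun w _ => ?_
  by_cases h : ((p : ℕ) : 𝓞 K) ∈ w.asIdeal
  · simp [h]
  · simp [h]


/-- **Bucket B, tier U, rank-one datum: the Selmer half of the twin IMC at `p = 3` HOLDS**
(`Ch_Λ X_𝔭′(E'/K_∞) = Λ`), modulo ONLY the two cited cohomological facts (Poitou–Tate duality for
Selmer structures over `K`; the local Euler–Poincaré characteristic). Inputs: `E'` multiplicative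
at `3` (non-split or `3 ∤ v_3 Δ_min`), `ρ̄_{E',3}` onto, `K` imaginary quadratic Heegner for
`N' = N(E')`, a degree-one `𝔭' ∣ 3`, a NON-TORSION `P ∈ E'(K)` with the UNIT data
`ord_3 log_ω P = 1` (at `embAt K 3 𝔭'`), `3 ∤ ∏_w c_w(E'/K)`, `3 ∤ [E'(K) : ℤP]`, and
`rank E'(K) = 1`, `Ш(E'/K)[3^∞] = 0` (at a unit Heegner pair these four are Gross 1991 Props.
2.1/2.3 at `p = 3` + the census flag). Mechanism: X11b's EXACT COUNT
`baseSelmerCountAt_of_rankOne_primary` gives `#Sel_{𝔭'}(K, E'[3^∞]) = 3^a`,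
`a = ord_3 #Ш[3^∞] + 2((ord_3 log P − 1) − ord_3 [E'(K):ℤP]) + ord_3 ∏_{w∣3} c_w = 0`, so the base
Selmer group vanishes; then vanishing control (`hasCharValuationAt_zero_of_atoms`) with the local
atoms `LocalTorsionMult.localTorsion_eq_zero_of_mult` (erratum (iv) at `3`) and
`localKer_eq_bot_of_not_dvd_tamagawaProduct`. No JSW17 3.3.1 / Castella 2.3, no Λ-adic input.
[cite: JetchevSkinnerWan2017, Prop. 3.2.1 and (7.1.5)] [cite: GreenbergLNM1716, §3 Lemma 3.3, §4]
[cite: GrossLMS1991, §2 Props. 2.1, 2.3] -/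
theorem selmerHalf_instance_of_mult_unit (K : Type) [Field K] [NumberField K]
    (hPT : Literature.NumberTheory.GaloisCohomology.poitouTate_selmerStructure_duality K)
    (hEP : ∀ v : HeightOneSpectrum (𝓞 K),
      Literature.NumberTheory.GaloisRepresentations.localEulerPoincareCharacteristic
        (v.adicCompletion K))
    (W' : WeierstrassCurve ℚ) [W'.IsElliptic] [W'.IsGloballyMinimal] (N' : ℕ) [NeZero N']
    (hm : Mult W' 3)
    (hside : ¬ W'.HasSplitMultiplicativeReductionAtPrime 3 ∨
      ¬ 3 ∣ padicValInt 3 W'.minimalDiscriminantInt)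
    (hsurj : W'.HasSurjectiveModNGaloisRep 3) (hN' : W'.conductorNorm ℤ = N')
    (hK : IsImaginaryQuadratic K) (hH : SatisfiesHeegnerHypothesis N' K)
    (κ : ZpExtension K 3) (γ : absoluteGaloisGroup K) [Fact (κ.IsTopGenerator γ)]
    (𝔭' : HeightOneSpectrum (𝓞 K)) (h𝔭' : ((3 : ℕ) : 𝓞 K) ∈ 𝔭'.asIdeal)
    (he' : 𝔭'.asIdeal.ramificationIdx (𝓞 ℚ) = 1) (hf' : 𝔭'.asIdeal.inertiaDeg (𝓞 ℚ) = 1)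
    (P : (W'.baseChange K).toAffine.Point) (hP0 : ¬ IsOfFinAddOrder P)
    (hlog : Literature.NumberTheory.EllipticCurves.padicLogOrd W' 3 (embAt K 3 𝔭' h𝔭' he' hf') P = 1)
    (htam : ¬ 3 ∣ (W'.baseChange K).tamagawaProduct)
    (hidx : ¬ 3 ∣ (AddSubgroup.zmultiples P).index)
    (hrk : (W'.baseChange K).mordellWeilRank = 1)
    (hSha : AddCommGroup.primaryComponent (W'.baseChange K).sha 3 = ⊥) :
    XAc.HasCharValuationAt (W'.baseChange K) 3 κ 𝔭' ∅ γ 0 := by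
  haveI : IsTotallyComplex K := IsImaginaryQuadratic.isTotallyComplex hK
  haveI : (W'.baseChange K).IsElliptic := by rw [WeierstrassCurve.baseChange]; infer_instance
  have hirr : Irr W' 3 := hasIrreducibleModPGaloisRep_of_hasSurjectiveModNGaloisRep W' 3 hsurj
  have hsplit : SplitsIn K 3 := hH 3 Nat.prime_three (hN' ▸ dvd_conductorNorm_of_mult hm)
  have hiv : ∀ R : (W'.baseChange ℚ_[3]).toAffine.Point, 3 • R = 0 → R = 0 :=
    LocalTorsionMult.localTorsion_eq_zero_of_mult W' 3 le_rfl hm hside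
  have hShafin : Finite (AddCommGroup.primaryComponent (W'.baseChange K).sha 3) := by
    rw [hSha]; infer_instance
  -- X11b's `padicLogOrd` (consumed by the count) and the Literature one (used by
  -- `IsUnitHeegnerPair`) have literally the same body.
  have hlog' : Summit.BirchSwinnertonDyer.Rank1Residual.X11b.padicLogOrd W' 3
      (embAt K 3 𝔭' h𝔭' he' hf') P = 1 := hlog
  obtain ⟨a, ⟨hfin, hcard⟩, ha⟩ := baseSelmerCountAt_of_rankOne_primary W' 3 K hPT hEP hm hirr hK
    hsplit hiv hrk hShafin P hP0 𝔭' h𝔭' he' hf'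
  have h1 : padicValNat 3 (Nat.card (AddCommGroup.primaryComponent (W'.baseChange K).sha 3)) = 0 := by
    rw [hSha, AddSubgroup.card_bot]; simp
  have h2 : padicValNat 3 (AddSubgroup.zmultiples P).index = 0 := padicValNat.eq_zero_of_not_dvd hidx
  have h3 : padicValNat 3 (tamagawaProductAbove W' K 3) = 0 :=
    padicValNat.eq_zero_of_not_dvd fun h ↦
      htam (h.trans (tamagawaProductAbove_dvd_tamagawaProduct W' K 3))
  rw [h1, h2, h3, hlog'] at ha
  have ha0 : a = 0 := by push_cast at ha; omega
  haveI := hfin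
  rw [ha0, pow_zero] at hcard
  exact hasCharValuationAt_zero_of_atoms (W'.baseChange K) 3 κ 𝔭' γ
    (noThreeTorsionAtPrime_of_mult W' hm hside K 𝔭' h𝔭' he' hf')
    (fun v hv ↦ localKer_eq_bot_of_not_dvd_tamagawaProduct (W'.baseChange K) 3 κ htam hv)
    (AddSubgroup.eq_bot_of_card_eq _ hcard)


/-- **Bucket C, tier U, rank-one datum: the Selmer half of the twin IMC at `p = 3` HOLDS**
(`Ch_Λ X_𝔭′(E'/K_∞) = Λ`) for `E'` GOOD SUPERSINGULAR at `3`, modulo ONLY the two cited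
cohomological facts. Inputs: `GoodSS E' 3`, `ρ̄_{E',3}` onto, `K` imaginary quadratic, a
degree-one `𝔭' ∣ 3` (so `3` splits), a NON-TORSION `P ∈ E'(K)` with `ord_3 log_ω P = 1` at
`embAt K 3 𝔭'`, `3 ∤ ∏_w c_w(E'/K)`, `3 ∤ [E'(K) : ℤP]`, `rank E'(K) = 1`, `Ш(E'/K)[3^∞] = 0`.
Mechanism: the generalised exact count `baseSelmerCountAt_of_rankOne_primary_red` (§0; the
reduction type enters X11b's count only as `3 ∤ #Ẽ'(𝔽₃)`, automatic here since `a₃(E') ∈ {0, ±3}`)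
gives `#Sel_{𝔭'}(K, E'[3^∞]) = 3^0`, then vanishing control with the atoms
`localTorsion_eq_zero_of_good_of_not_dvd_frobeniusTrace_sub_one` (Kim §3.1.1 at `3`) and
`localKer_eq_bot_of_not_dvd_tamagawaProduct`. No JSW17 3.3.1 / Castella 2.3 / CCSS18 thm57, no
Λ-adic or analytic input, no numeric `hIdx`. This is the Selmer side of item 20695 on tier U at
rank-one data. [cite: JetchevSkinnerWan2017, Prop. 3.2.1 and (7.1.5)]
[cite: GreenbergLNM1716, §3 Lemma 3.3, §4] [cite: Kim2022StructureSelmer, §3.1.1]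
[cite: GrossLMS1991, §2 Props. 2.1, 2.3] -/
theorem selmerHalf_instance_of_goodSS_unit (K : Type) [Field K] [NumberField K]
    (hPT : Literature.NumberTheory.GaloisCohomology.poitouTate_selmerStructure_duality K)
    (hEP : ∀ v : HeightOneSpectrum (𝓞 K),
      Literature.NumberTheory.GaloisRepresentations.localEulerPoincareCharacteristic
        (v.adicCompletion K))
    (W' : WeierstrassCurve ℚ) [W'.IsElliptic] [W'.IsGloballyMinimal]
    (hss : GoodSS W' 3) (hsurj : W'.HasSurjectiveModNGaloisRep 3) (hK : IsImaginaryQuadratic K)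
    (κ : ZpExtension K 3) (γ : absoluteGaloisGroup K) [Fact (κ.IsTopGenerator γ)]
    (𝔭' : HeightOneSpectrum (𝓞 K)) (h𝔭' : ((3 : ℕ) : 𝓞 K) ∈ 𝔭'.asIdeal)
    (he' : 𝔭'.asIdeal.ramificationIdx (𝓞 ℚ) = 1) (hf' : 𝔭'.asIdeal.inertiaDeg (𝓞 ℚ) = 1)
    (P : (W'.baseChange K).toAffine.Point) (hP0 : ¬ IsOfFinAddOrder P)
    (hlog : Literature.NumberTheory.EllipticCurves.padicLogOrd W' 3 (embAt K 3 𝔭' h𝔭' he' hf') P = 1)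
    (htam : ¬ 3 ∣ (W'.baseChange K).tamagawaProduct)
    (hidx : ¬ 3 ∣ (AddSubgroup.zmultiples P).index)
    (hrk : (W'.baseChange K).mordellWeilRank = 1)
    (hSha : AddCommGroup.primaryComponent (W'.baseChange K).sha 3 = ⊥) :
    XAc.HasCharValuationAt (W'.baseChange K) 3 κ 𝔭' ∅ γ 0 := by
  haveI : IsTotallyComplex K := IsImaginaryQuadratic.isTotallyComplex hK
  haveI : (W'.baseChange K).IsElliptic := by rw [WeierstrassCurve.baseChange]; infer_instance
  have hirr : Irr W' 3 := hasIrreducibleModPGaloisRep_of_hasSurjectiveModNGaloisRep W' 3 hsurj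
  have hred : ¬ 3 ∣ W'.reductionPointCount 3 := not_dvd_reductionPointCount_of_goodSS W' hss
  have hsplit : SplitsIn K 3 := by
    have h := (splitsIn_primesEquiv_under_iff (IsImaginaryQuadratic.finrank_eq_two hK) 𝔭').mpr
      ⟨he', hf'⟩
    rwa [under_eq_ratPlace_of_mem h𝔭', primesEquiv_ratPlace] at h
  have hiv : ∀ R : (W'.baseChange ℚ_[3]).toAffine.Point, 3 • R = 0 → R = 0 :=
    localTorsion_eq_zero_of_good_of_not_dvd_frobeniusTrace_sub_one W' 3 le_rfl hss.1 fun h1 ↦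
      hred ((dvd_reductionPointCount_iff_dvd_frobeniusTrace_sub_one W' 3).mpr h1)
  have hShafin : Finite (AddCommGroup.primaryComponent (W'.baseChange K).sha 3) := by
    rw [hSha]; infer_instance
  have hlog' : Summit.BirchSwinnertonDyer.Rank1Residual.X11b.padicLogOrd W' 3
      (embAt K 3 𝔭' h𝔭' he' hf') P = 1 := hlog
  obtain ⟨a, ⟨hfin, hcard⟩, ha⟩ := baseSelmerCountAt_of_rankOne_primary_red W' 3 K hPT hEP hred hirr
    hK hsplit hiv hrk hShafin P hP0 𝔭' h𝔭' he' hf'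
  have h1 : padicValNat 3 (Nat.card (AddCommGroup.primaryComponent (W'.baseChange K).sha 3)) = 0 := by
    rw [hSha, AddSubgroup.card_bot]; simp
  have h2 : padicValNat 3 (AddSubgroup.zmultiples P).index = 0 := padicValNat.eq_zero_of_not_dvd hidx
  have h3 : padicValNat 3 (tamagawaProductAbove W' K 3) = 0 :=
    padicValNat.eq_zero_of_not_dvd fun h ↦
      htam (h.trans (tamagawaProductAbove_dvd_tamagawaProduct W' K 3))
  rw [h1, h2, h3, hlog'] at ha
  have ha0 : a = 0 := by push_cast at ha; omega
  haveI := hfin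
  rw [ha0, pow_zero] at hcard
  exact hasCharValuationAt_zero_of_atoms (W'.baseChange K) 3 κ 𝔭' γ
    (noThreeTorsionAtPrime_of_goodSS W' hss K 𝔭' h𝔭' he' hf')
    (fun v hv ↦ localKer_eq_bot_of_not_dvd_tamagawaProduct (W'.baseChange K) 3 κ htam hv)
    (AddSubgroup.eq_bot_of_card_eq _ hcard)


end Summit.BirchSwinnertonDyer.BirchSwinnertonDyer.Theorems.UniversalToricDescentTwinSplit.VanishingControl

end
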